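import Literature.NumberTheory.NumberFields.KummerRankUnramifiedOutsideP
import HarnessLib

/-!
# Lang's Theorem 2.1 with ramification at `p` allowed — III: the CM-extension form `L/F` with an INERTIA-GROUP
# hypothesis (the shape produced by absolute Galois groups)

Topic `NumberTheory/NumberFields`; namespace `Literature.NumberTheory.NumberFields`.  Theorem-only file (no
definition, no named fact, no `sorry`), unconditional.  Written by the prover seat `bsd-eis-lam-a` g20 (cell `bsd-eis`,
`--supports` stmt-BirchSwinnertonDyer-19035, stub `stub_publishedL59`).  Adapter between Part II
(`IsCMField.natCard_aut_le_of_isUnramifiedIn_outside`, stated over the maximal real subfield `L⁺` of a CM field `L`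
with the unramified hypothesis in the form `Algebra.IsUnramifiedIn`) and its consumer (classes of `H¹` over a
`ℤ_p`-tower, which produce an abelian extension `E` of an ABSTRACT totally real field `F` with `L/F` a CM extension
and with TRIVIAL INERTIA GROUPS `I_Q ≤ Gal(E/F)` at the primes `Q ∌ p`):

* `isUnramifiedIn_of_forall_inertia_eq_one` — for a finite Galois extension `E/F` of number fields and a prime `v`
  of `F` not containing `q`: if every `σ` in the inertia group of a maximal `Q ∌ q` of `𝓞_E` is trivial, then `v`
  is unramified in `E` (`#I_Q = e(Q|v)`, Mathlib `Ideal.card_inertia_eq_ramificationIdxIn`).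
* `IsCMField.natCard_aut_le_of_forall_inertia_eq_one` — Part II with the inertia hypothesis.
* **`IsCMField.natCard_aut_le_of_forall_inertia_eq_one_of_ringEquiv`** — for a CM field `L ∋ ζ_p` (`p` odd), a field
  `F` with a ring isomorphism `e : F ≃+* L⁺` onto the maximal real subfield, and a finite Galois `E/F` with commutative
  group of exponent `p` whose inertia groups at the maximal ideals `Q ∌ p` of `𝓞_E` are trivial:
  `#Gal(E/F) ≤ p ^ (1 + s) · #(Cl_L[p] ∩ ker N_{L/L⁺})`, `s` = number of primes of `L` above `p` (transport along `e`,
  Mathlib `IsGalois.of_equiv_equiv`, `Module.Finite.of_equiv_equiv`).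

## References

* S. Lang, *Cyclotomic Fields I and II*, GTM 121 (1990), Ch. 13 §2, Thm. 2.1 (i) (proof). [Lang1990]
* R. Greenberg, *Iwasawa theory for elliptic curves*, LNM 1716 (1999), §5 Lemma 5.9 (proof). [GreenbergLNM1716]
* J. Neukirch, *Algebraic Number Theory* (1999), Ch. I §9 (9.6), (9.9) (inertia groups and `e`). [NeukirchANT1999]
-/

noncomputable section

open NumberField NumberField.IsCMField IsDedekindDomain Module IntermediateField
open scoped nonZeroDivisors

namespace Literature.NumberTheory.NumberFields

section Inertia

variable {F E : Type} [Field F] [NumberField F] [Field E] [NumberField E] [Algebra F E]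
  [FiniteDimensional F E] [IsGalois F E]

/-- **Trivial inertia groups away from `q` give unramifiedness away from `q`.**  `E/F` finite Galois of number
fields; if for every maximal ideal `Q` of `𝓞_E` not containing `q` every element of the inertia group
`I_Q ≤ Gal(E/F)` is trivial, then every prime `v ∌ q` of `F` is unramified in `E` (`e(P|v) = #I_P = 1`).
[cite: NeukirchANT1999, Ch. I §9 Prop. (9.6) and (9.9)] -/
theorem isUnramifiedIn_of_forall_inertia_eq_one (q : ℕ)
    (h : ∀ (Q : Ideal (𝓞 E)) [Q.IsMaximal], ((q : ℕ) : 𝓞 E) ∉ Q →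
      ∀ σ ∈ Q.inertia (E ≃ₐ[F] E), σ = 1)
    (v : HeightOneSpectrum (𝓞 F)) (hv : ((q : ℕ) : 𝓞 F) ∉ v.asIdeal) :
    Algebra.IsUnramifiedIn (𝓞 E) v.asIdeal := by
  classical
  haveI : Module.Finite (𝓞 F) (𝓞 E) := IsIntegralClosure.finite (𝓞 F) F E (𝓞 E)
  haveI : IsGaloisGroup (E ≃ₐ[F] E) (𝓞 F) (𝓞 E) :=
    IsGaloisGroup.of_isFractionRing (E ≃ₐ[F] E) (𝓞 F) (𝓞 E) F E
  rw [Algebra.isUnramifiedIn_iff_forall_ramificationIdx_eq_one]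
  intro P hP hPv
  haveI := hP
  haveI := hPv
  haveI := v.isPrime
  have hP0 : P ≠ ⊥ := Ideal.ne_bot_of_liesOver_of_ne_bot v.ne_bot P
  haveI : P.IsMaximal := hP.isMaximal hP0
  have hqP : ((q : ℕ) : 𝓞 E) ∉ P := by
    intro hq
    apply hv
    rw [hPv.over, Ideal.under_def, Ideal.mem_comap, map_natCast]
    exact hq
  have hbot : P.inertia (E ≃ₐ[F] E) = ⊥ := (Subgroup.eq_bot_iff_forall _).mpr (h P hqP)
  rw [← Ideal.ramificationIdxIn_eq_ramificationIdx v.asIdeal P (E ≃ₐ[F] E),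
    ← Ideal.card_inertia_eq_ramificationIdxIn (G := E ≃ₐ[F] E) v.asIdeal P, hbot, Subgroup.card_bot]

end Inertia

section MaximalRealSubfield

variable (K : Type) [Field K] [NumberField K] [IsCMField K]

/-- **Part II with the inertia hypothesis**: for a CM field `K ∋ ζ_p` (`p` odd) and a finite Galois extension `E`
of `K⁺` with commutative group of exponent `p` whose inertia groups at the maximal ideals `Q ∌ p` of `𝓞_E` are
trivial, `#Gal(E/K⁺) ≤ p ^ (1 + s) · #(Cl_K[p] ∩ ker N_{K/K⁺})`.
[cite: Lang1990, Ch. 13 §2, Thm. 2.1 (i) (proof)] [cite: GreenbergLNM1716, §5 Lemma 5.9 (proof, pp. 143–144)] -/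
theorem IsCMField.natCard_aut_le_of_forall_inertia_eq_one {p : ℕ} (hp : p.Prime) (hp2 : p ≠ 2) {ζ : K}
    (hζ : IsPrimitiveRoot ζ p)
    (E : Type) [Field E] [NumberField E] [Algebra (maximalRealSubfield K) E]
    [FiniteDimensional (maximalRealSubfield K) E] [IsGalois (maximalRealSubfield K) E]
    [IsMulCommutative (E ≃ₐ[maximalRealSubfield K] E)]
    (hEexp : ∀ σ : E ≃ₐ[maximalRealSubfield K] E, σ ^ p = 1)
    (hinert : ∀ (Q : Ideal (𝓞 E)) [Q.IsMaximal], ((p : ℕ) : 𝓞 E) ∉ Q →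
      ∀ σ ∈ Q.inertia (E ≃ₐ[maximalRealSubfield K] E), σ = 1) :
    Nat.card (E ≃ₐ[maximalRealSubfield K] E) ≤
      p ^ (1 + Nat.card {v : HeightOneSpectrum (𝓞 K) // ((p : ℕ) : 𝓞 K) ∈ v.asIdeal}) *
        Nat.card ↥((powMonoidHom p : ClassGroup (𝓞 K) →* ClassGroup (𝓞 K)).ker ⊓
          (classGroupNorm (maximalRealSubfield K) K).ker) :=
  IsCMField.natCard_aut_le_of_isUnramifiedIn_outside K hp hp2 hζ E hEexp
    (fun v hv => isUnramifiedIn_of_forall_inertia_eq_one p hinert v hv)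

end MaximalRealSubfield

section RingEquiv

variable (F L : Type) [Field F] [Field L] [NumberField L] [IsCMField L]

/-- **Lang's Theorem 2.1 (i) with ramification above `p` allowed, over a field `F` ISOMORPHIC to the maximal real
subfield of a CM field `L`.**  Let `L` be a CM number field containing a primitive `p`-th root of unity (`p` odd),
`e : F ≃+* L⁺` a ring isomorphism onto its maximal real subfield, and `E/F` a finite Galois extension with commutative
group of exponent `p` such that for every maximal ideal `Q ∌ p` of `𝓞_E` every element of the inertia group
`I_Q ≤ Gal(E/F)` is trivial (i.e. `E/F` is unramified outside `p`).  Then `#Gal(E/F) ≤ p ^ (1 + s) · #(Cl_L[p] ∩ ker N_{L/L⁺})`,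
`s` the number of primes of `𝓞_L` containing `p` (reflection: the exponent-`p` abelian extensions of a totally real field
unramified outside `p` are controlled by the MINUS part of the class group of `L = F(ζ_p)`; Greenberg's Lemma 5.9, proof,
one layer).  The base change along `e` uses Mathlib's `IsGalois.of_equiv_equiv` / `Module.Finite.of_equiv_equiv`.
[cite: Lang1990, Ch. 13 §2, Thm. 2.1 (i) (proof)] [cite: GreenbergLNM1716, §5 Lemma 5.9 (proof, pp. 143–144)] -/
theorem IsCMField.natCard_aut_le_of_forall_inertia_eq_one_of_ringEquiv {p : ℕ} (hp : p.Prime) (hp2 : p ≠ 2) {ζ : L}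
    (hζ : IsPrimitiveRoot ζ p) (e : F ≃+* maximalRealSubfield L)
    (E : Type) [Field E] [NumberField E] [Algebra F E] [FiniteDimensional F E] [IsGalois F E]
    [IsMulCommutative (E ≃ₐ[F] E)]
    (hEexp : ∀ σ : E ≃ₐ[F] E, σ ^ p = 1)
    (hinert : ∀ (Q : Ideal (𝓞 E)) [Q.IsMaximal], ((p : ℕ) : 𝓞 E) ∉ Q →
      ∀ σ ∈ Q.inertia (E ≃ₐ[F] E), σ = 1) :
    Nat.card (E ≃ₐ[F] E) ≤
      p ^ (1 + Nat.card {v : HeightOneSpectrum (𝓞 L) // ((p : ℕ) : 𝓞 L) ∈ v.asIdeal}) *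
        Nat.card ↥((powMonoidHom p : ClassGroup (𝓞 L) →* ClassGroup (𝓞 L)).ker ⊓
          (classGroupNorm (maximalRealSubfield L) L).ker) := by
  classical
  -- `E` as an `L⁺`-algebra through `e`
  letI algE : Algebra (maximalRealSubfield L) E := ((algebraMap F E).comp e.symm.toRingHom).toAlgebra
  have halg : ∀ y : maximalRealSubfield L,
      algebraMap (maximalRealSubfield L) E y = algebraMap F E (e.symm y) := fun _ => rfl
  have halg' : ∀ x : F, algebraMap (maximalRealSubfield L) E (e x) = algebraMap F E x := fun x => by
    rw [halg, RingEquiv.symm_apply_apply]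
  have hcomp : (algebraMap (maximalRealSubfield L) E).comp (e : F →+* maximalRealSubfield L) =
      ((RingEquiv.refl E : E ≃+* E) : E →+* E).comp (algebraMap F E) := by
    ext x
    exact halg' x
  haveI : Module.Finite (maximalRealSubfield L) E := Module.Finite.of_equiv_equiv e (RingEquiv.refl E) hcomp
  haveI : IsGalois (maximalRealSubfield L) E := IsGalois.of_equiv_equiv (f := e) (g := RingEquiv.refl E) hcomp
  -- the Galois groups over `F` and over `L⁺` are the same automorphisms
  let toL : (E ≃ₐ[F] E) → (E ≃ₐ[maximalRealSubfield L] E) := fun σ =>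
    { σ.toRingEquiv with
      commutes' := fun y => by
        change σ (algebraMap (maximalRealSubfield L) E y) = algebraMap (maximalRealSubfield L) E y
        rw [halg]
        exact σ.commutes _ }
  let toF : (E ≃ₐ[maximalRealSubfield L] E) → (E ≃ₐ[F] E) := fun τ =>
    { τ.toRingEquiv with
      commutes' := fun x => by
        change τ (algebraMap F E x) = algebraMap F E x
        rw [← halg']
        exact τ.commutes _ }
  let ψ : (E ≃ₐ[F] E) ≃* (E ≃ₐ[maximalRealSubfield L] E) :=
    { toFun := toL
      invFun := toF
      left_inv := fun σ => AlgEquiv.ext fun x => rfl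
      right_inv := fun τ => AlgEquiv.ext fun x => rfl
      map_mul' := fun a b => AlgEquiv.ext fun x => rfl }
  haveI : IsMulCommutative (E ≃ₐ[maximalRealSubfield L] E) :=
    ⟨⟨fun a b => ψ.symm.injective (by
      rw [map_mul, map_mul]; exact IsMulCommutative.is_comm.comm _ _)⟩⟩
  have hEexp' : ∀ τ : E ≃ₐ[maximalRealSubfield L] E, τ ^ p = 1 := fun τ => by
    obtain ⟨σ, rfl⟩ := ψ.surjective τ
    rw [← map_pow, hEexp, map_one]
  have hinert' : ∀ (Q : Ideal (𝓞 E)) [Q.IsMaximal], ((p : ℕ) : 𝓞 E) ∉ Q →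
      ∀ τ ∈ Q.inertia (E ≃ₐ[maximalRealSubfield L] E), τ = 1 := by
    intro Q hQ hpQ τ hτ
    obtain ⟨σ, rfl⟩ := ψ.surjective τ
    have hσ : σ ∈ Q.inertia (E ≃ₐ[F] E) := by
      rw [AddSubgroup.mem_inertia] at hτ ⊢
      intro x
      have h1 := hτ x
      have e1 : (ψ σ) • x = σ • x := by
        apply Subtype.ext
        rfl
      rwa [e1] at h1
    rw [hinert Q hpQ σ hσ, map_one]
  have hcard : Nat.card (E ≃ₐ[F] E) = Nat.card (E ≃ₐ[maximalRealSubfield L] E) :=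
    Nat.card_congr ψ.toEquiv
  rw [hcard]
  exact IsCMField.natCard_aut_le_of_forall_inertia_eq_one L hp hp2 hζ E hEexp' hinert'

end RingEquiv

end Literature.NumberTheory.NumberFields

end
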